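/-
Copyright (c) 2026. All rights reserved.
Released under Apache 2.0 license as described in the file LICENSE.
Authors: abc-iut cell, prover seat abc-iut-f-066 (gen 8; row «F3081 BUILD r1» B2b, abc-iut-L4-lead m211/m212), over this
seat's `LogFrobeniusRealisesRelLiftsTS.lean` (B1), abc-iut-f-102's `LogFrobeniusRealisesGenerators.lean` /
`LogFrobeniusRealisesRelLifts.lean` (the `ι⊞`-move system and THEOREM B's datum) and abc-iut-L4-t5's lifting pairs
(`DiagramPathEmbeddings.lean`) — every input consumed BY NAME; nothing of those files is restated.
-/
import Literature.AnabelianGeometry.AbsoluteAnabelian.LogFrobeniusRealisesRelLiftsTS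
import Literature.AnabelianGeometry.AbsoluteAnabelian.DiagramRelativeFamiliesUnion
import HarnessLib

/-!
# [AbsTopIII] Cor 5.5 (iii) on `D•⊢`: `ι⊞`-chains pushed along `𝒩⊞_v → 𝒩_v` are boundary pairs of `S_log_v` (the cross law `𝒩⊞_v → 𝒩_v`)

S. Mochizuki, *Topics in absolute anabelian geometry III: global reconstruction algorithms* [MochizukiAbsTopIII2015];
locators `p.N` = pages of the author's manuscript (`paper:url-5493eb38cbb7`), read on the page: Cor 5.5 (iii) p. 131 ("the
families of homotopies that constitute `S_log` and `S_log⊞` are compatible with one another", `λ_{v,ν}` = `λ⊞_{v,ν}` followed by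
`𝒩⊞_v → 𝒩_v`, Def 5.4 (iv) p. 127; `ι|_{Γ⃗^⋉} = ι⊞`, Def 5.4 (iii) p. 126), Def 3.5 (ii) p. 75, §0 p. 26.

PROOF-ONLY bookkeeping for F-3081 (`Cor55ObservablesCompatible`, abc-iut-L4-t3), brick B2b of this seat's line: the CROSS LAW
(abc-iut-f-101's `RelLifts.CrossLaw`) from abc-iut-f-102's THEOREM-B datum `realisesRelLifts A Ξ hsq hpre hpost` (pivots the cores
and the `𝒩⊞_v`) to B1's `TS`-datum `tsRelLifts Hts` (pivots the `𝒩_v`).  The only arrows from a pivot of the first to a pivot of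
the second are the `𝒩⊞_v → 𝒩_v` (`path_pivot_nv`); along them a related pair at `𝒩⊞_v` — a chain of `ι⊞`-moves
(abc-iut-f-102's `LGen`, `Chain`) — becomes a lifting pair of `S_log_v = Hts v`, with the whiskered homotopy, PROVIDED `Hts v` is a
`TS`-observable (`IsLogObservableTS`: its boundary set contains the printed generator pairs `([λ_{ν₁}], [λ_{ν₂}])`,
`([λ_{sl}]∘[id]∘[log], [λ_{ν₂}]∘[id])` with homotopies `ι_{v,ε}`, and `ι_{v,ε.toTS} = ι⊞_{v,ε} ▷ (𝒩⊞_v → 𝒩_v)` by the `TS`-datum's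
`iota_toTS`) and reflexive on the paths into `𝒩_v` (`hrefl`, the empty chain): generators (`liftE_lgen_push`), moves
(abc-iut-L4-t5's `lift_precomp`), chains (`lift_trans`, `liftη_self`) — ★ `crossLaw_realises_ts`.
HONEST LABEL: MODEL-LEVEL bookkeeping over OUR typed interface; refereed pre-IUT material; nothing here bears on [IUTchIII]
Cor. 3.12; no side taken; typed ≠ proved.
-/

set_option autoImplicit false

universe u

open CategoryTheory Quiver

namespace Literature.AnabelianGeometry.AbsoluteAnabelian

namespace LogFrobeniusSetting

open DiagramOfCategories

variable {Vmod : Type u} {isArc : Vmod → Bool} (L : LogFrobeniusSetting Vmod isArc)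

/-! ## §0. Bookkeeping -/

section Helpers

/-- heterogeneous equality of natural transformations from componentwise `eqToHom`-conjugation along equal functors
(bookkeeping). [folklore] -/
private theorem natTrans_heq_of_app_conj₂ {A B : Type*} [Category A] [Category B] {F G F' G' : A ⥤ B} (hF : F = F')
    (hG : G = G') {α : F ⟶ G} {β : F' ⟶ G'}
    (h : ∀ x, α.app x = eqToHom (Functor.congr_obj hF x) ≫ β.app x ≫ eqToHom (Functor.congr_obj hG x).symm) : HEq α β := by
  subst hF hG
  apply heq_of_eq
  ext x
  simpa using h x

/-- components of heterogeneously equal natural transformations between equal functors (bookkeeping). [folklore] -/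
private theorem app_eq_conj_of_heq {A B : Type*} [Category A] [Category B] {F G F' G' : A ⥤ B} (hF : F = F') (hG : G = G')
    {α : F ⟶ G} {β : F' ⟶ G'} (h : HEq α β) (x : A) :
    α.app x = eqToHom (Functor.congr_obj hF x) ≫ β.app x ≫ eqToHom (Functor.congr_obj hG x).symm := by
  subst hF hG
  cases h
  simp

/-- identities of equal functors are heterogeneously equal (bookkeeping). [folklore] -/
private theorem heq_id_of_eq_functor {A B : Type*} [Category A] [Category B] {F G : A ⥤ B} (h : F = G) :
    HEq (𝟙 F) (𝟙 G) := by
  subst h; rfl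

/-- path functors of equal diagrams are heterogeneously equal (bookkeeping). [folklore] -/
private theorem pathFunctor_heq_of_diagram_eq {V : Type u} [Quiver.{u} V] {D₁ D₂ : DiagramOfCategories.{u, u + 1, u} V}
    (h : D₁ = D₂) {a b : V} (p : Path a b) : HEq (D₁.pathFunctor p) (D₂.pathFunctor p) := by
  subst h; rfl

/-- two double `eqToHom`-conjugates of heterogeneously equal morphisms with the same outer ends agree (bookkeeping). [folklore] -/
private theorem eqToHom_conj₂₂_eq {C : Type*} [Category C] {a₀ a₁ a₂ b₂ b₁ b₀ a₁' a₂' b₂' b₁' : C} {g : a₂ ⟶ b₂}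
    {g' : a₂' ⟶ b₂'} (ha : a₂ = a₂') (hb : b₂ = b₂') (hg : HEq g g')
    (p₁ : a₀ = a₁) (p₂ : a₁ = a₂) (q₂ : b₂ = b₁) (q₁ : b₁ = b₀) (p₁' : a₀ = a₁') (p₂' : a₁' = a₂') (q₂' : b₂' = b₁')
    (q₁' : b₁' = b₀) :
    eqToHom p₁ ≫ (eqToHom p₂ ≫ g ≫ eqToHom q₂) ≫ eqToHom q₁ = eqToHom p₁' ≫ (eqToHom p₂' ≫ g' ≫ eqToHom q₂') ≫ eqToHom q₁' := by
  cases ha; cases hb; cases hg; cases p₁; cases p₂; cases q₂; cases q₁; cases p₁'; cases q₁'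
  simp

/-- a functor equation acts heterogeneously on a morphism (bookkeeping). [folklore] -/
private theorem map_heq_of_functor_eq_push {A B : Type*} [Category A] [Category B] {F G : A ⥤ B} (h : F = G) {Y Z : A}
    (f : Y ⟶ Z) : HEq (F.map f) (G.map f) := by
  subst h; rfl

end Helpers

/-! ## §1. Arrows from the pivots of THEOREM B into the `𝒩_v` -/

section Paths

/-- the arrow `[𝒩⊞_v → 𝒩_v]` as a path of `Γ⃗_{D•⊢}`. [cite: MochizukiAbsTopIII2015, Cor 5.5 (iii) p. 131] -/
abbrev fgtP (v : Vmod) : Path (DVertex.nplus v : DVertex Vmod isArc) (.nv v) := Path.nil.cons (DEdge.forget v)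

/-- the path functor of `[𝒩⊞_v → 𝒩_v]` is `𝒩⊞_v → 𝒩_v`. [cite: MochizukiAbsTopIII2015, Cor 5.5 (iii) p. 131] -/
theorem pathFunctor_fgtP (v : Vmod) : L.diagram.pathFunctor (fgtP (isArc := isArc) v) = L.forget v := by
  rw [DiagramOfCategories.pathFunctor_cons, DiagramOfCategories.pathFunctor_nil]
  exact Functor.id_comp _

/-- **The only paths from a pivot of THEOREM B (a core vertex or an `𝒩⊞_{v}`) into an `𝒩_{v'}`** are the arrows `𝒩⊞_v → 𝒩_v`
(cores lie in rows ≥ 5, `𝒩_v` in row 4; abc-iut-f-102's `path_nplus_nplus`). [cite: MochizukiAbsTopIII2015, Cor 5.5 p. 129] -/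
theorem path_pivot_nv {w : DVertex Vmod isArc} (hw : IsPivot w) {v' : Vmod} (t : Path w (DVertex.nv v')) :
    ∃ (_ : w = .nplus v'), HEq t (fgtP (isArc := isArc) v') := by
  cases w with
  | nplus v =>
    cases t with
    | cons t e =>
      cases e
      obtain ⟨rfl, ht⟩ := path_nplus_nplus t
      cases ht
      exact ⟨rfl, HEq.rfl⟩
  | e5 => exact absurd (DVertex.row_le_of_path t) (by simp [DVertex.row])
  | an => exact absurd (DVertex.row_le_of_path t) (by simp [DVertex.row])
  | e7 => exact absurd (DVertex.row_le_of_path t) (by simp [DVertex.row])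
  | _ => exact hw.elim

end Paths

/-! ## §2. Generators, moves, chains of `ι⊞`-moves pushed along `𝒩⊞_v → 𝒩_v` -/

section Push

variable (Hts : ∀ v : Vmod, (L.logDiagramTS v).HomotopyFamily) (T : L.TSHomotopies) (v : Vmod)
  (hobs : L.IsLogObservableTS T v (Hts v))
  (hrefl : ∀ {a' : (logShapeTS (isArc := isArc) v).Vertex} (p : Path a' (logShapeTS (isArc := isArc) v).obs), (Hts v).E p p)

/-- the path functor of the presentation along the embedding is the path functor of `D•⊢` (abc-iut-f-102's
`extend_eq_comapAlong` + abc-iut-L4-t5's `pathFunctor_comapAlong`), heterogeneously. [cite: MochizukiAbsTopIII2015, Definition 3.5 (i) p.75] -/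
theorem pathFunctor_logDiagramTS_heq {a' b' : (logShapeTS (isArc := isArc) v).Vertex} (p : Path a' b') :
    HEq ((L.logDiagramTS v).pathFunctor p)
      (L.diagram.pathFunctor ((embExt (InPortionThree (isArc := isArc) v) (.nv v)).mapPath p)) :=
  (pathFunctor_heq_of_diagram_eq (L.extend_eq_comapAlong (InPortionThree v) (.nv v)) p).trans
    (heq_of_eq (L.diagram.pathFunctor_comapAlong (embExt (InPortionThree (isArc := isArc) v) (.nv v)) p))

include hobs in
/-- **A GENERATOR pair pushed along `𝒩⊞_v → 𝒩_v` is a boundary pair of `S_log_v` with homotopy `ι⊞_{v,ε} ▷ (𝒩⊞_v → 𝒩_v)`**: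
the printed generator pairs of `S_log⊞_v` (abc-iut-f-102's `LGen`) followed by the forget arrow ARE the printed generator pairs of
`S_log_v` (Cor 5.5 (iii): `λ_{v,ν} = [𝒩⊞_v → 𝒩_v] ∘ [λ⊞_{v,ν}]`), and `ι_{v,ε} = ι⊞_{v,ε} ▷ (𝒩⊞_v → 𝒩_v)` on `Γ⃗^⋉_v` (Def 5.4 (iii)).
[cite: MochizukiAbsTopIII2015, Cor 5.5 (iii) p. 131] -/
theorem liftE_lgen_push {c : DVertex Vmod isArc} {g g' : Path c (DVertex.nplus v)} (s : LGen (isArc := isArc) v g g') :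
    ∃ h : liftE (embExt (InPortionThree (isArc := isArc) v) (.nv v)) L.diagram (logShapeTS (isArc := isArc) v).obs
      (L.tsLiftFamily Hts v) (g.comp (fgtP v)) (g'.comp (fgtP v)),
      HEq (liftη (embExt (InPortionThree (isArc := isArc) v) (.nv v)) L.diagram (logShapeTS (isArc := isArc) v).obs
        (L.tsLiftFamily Hts v) h)
        (Functor.whiskerRight (L.lgenHom v s) (L.diagram.pathFunctor (fgtP (isArc := isArc) v))) := by
  cases s with
  | pre ν₁ ν₂ ε h₁ h₂ =>
    obtain ⟨hmem, happ⟩ := hobs.2.1 ν₁ ν₂ ε.toTS h₁ h₂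
    obtain ⟨h, hθ⟩ := L.tsRelLifts_rel_of_mem Hts v hmem
    refine ⟨h, ?_⟩
    rw [tsRelLifts_θ_eq] at hθ
    refine natTrans_heq_of_app_conj₂ (L.diagram.pathFunctor_comp (lamP v ν₁ h₁) (fgtP v))
      (L.diagram.pathFunctor_comp (lamP v ν₂ h₂) (fgtP v)) (fun X₀ => ?_)
    obtain ⟨hobj, hobj', e⟩ := happ X₀
    have e1 := app_eq_conj_of_heq (eq_of_heq (L.pathFunctor_logDiagramTS_heq v (lamPathTS v ν₁ h₁))).symm
      (eq_of_heq (L.pathFunctor_logDiagramTS_heq v (lamPathTS v ν₂ h₂))).symm hθ X₀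
    change (liftη (embExt (InPortionThree (isArc := isArc) v) (.nv v)) L.diagram (logShapeTS (isArc := isArc) v).obs
        (L.tsLiftFamily Hts v) h).app X₀ = _
    rw [e1, e, T.iota_toTS v ε]
    simp only [Functor.whiskerRight_app, NatTrans.comp_app, eqToHom_app, Functor.map_comp, eqToHom_map, lgenHom]
    exact eqToHom_conj₂₂_eq (Functor.congr_obj (L.pathFunctor_fgtP v).symm _) (Functor.congr_obj (L.pathFunctor_fgtP v).symm _)
      (map_heq_of_functor_eq_push (L.pathFunctor_fgtP v).symm ((L.iota v ε).app X₀)) _ _ _ _ _ _ _ _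
  | post ν₁ ν₂ ε h₁ h₂ hsl n =>
    obtain ⟨hmem, happ⟩ := hobs.2.2 ν₁ ν₂ ε.toTS h₁ h₂ hsl n
    obtain ⟨h, hθ⟩ := L.tsRelLifts_rel_of_mem Hts v hmem
    refine ⟨h, ?_⟩
    rw [tsRelLifts_θ_eq] at hθ
    refine natTrans_heq_of_app_conj₂ (L.diagram.pathFunctor_comp (postDomP v n hsl) (fgtP v))
      (L.diagram.pathFunctor_comp (postCodP v n ν₂ h₂) (fgtP v)) (fun X₀ => ?_)
    obtain ⟨hobj, hobj', e⟩ := happ X₀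
    have e1 := app_eq_conj_of_heq (eq_of_heq (L.pathFunctor_logDiagramTS_heq v (postLogDomPathTS v n hsl))).symm
      (eq_of_heq (L.pathFunctor_logDiagramTS_heq v (postLogCodPathTS v n ν₂ h₂))).symm hθ X₀
    change (liftη (embExt (InPortionThree (isArc := isArc) v) (.nv v)) L.diagram (logShapeTS (isArc := isArc) v).obs
        (L.tsLiftFamily Hts v) h).app X₀ = _
    rw [e1, e, T.iota_toTS v ε]
    simp only [Functor.whiskerRight_app, NatTrans.comp_app, eqToHom_app, Functor.map_comp, eqToHom_map, lgenHom]
    exact eqToHom_conj₂₂_eq (Functor.congr_obj (L.pathFunctor_fgtP v).symm _) (Functor.congr_obj (L.pathFunctor_fgtP v).symm _)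
      (map_heq_of_functor_eq_push (L.pathFunctor_fgtP v).symm ((L.iota v ε).app X₀)) _ _ _ _ _ _ _ _

include hobs in
/-- **A MOVE pushed along `𝒩⊞_v → 𝒩_v`** (a generator pair preceded by a common path `[r]`): a lifting pair of `S_log_v`
(abc-iut-L4-t5's `lift_precomp`, the portion is a sieve) with the whiskered move homotopy. [cite: MochizukiAbsTopIII2015, Definition 3.5 (ii) p.75] -/
theorem liftE_move_push {a : DVertex Vmod isArc} {p p' : Path a (DVertex.nplus v)}
    (m : DiagramOfCategories.Move (LGen (isArc := isArc) v) p p') :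
    ∃ h : liftE (embExt (InPortionThree (isArc := isArc) v) (.nv v)) L.diagram (logShapeTS (isArc := isArc) v).obs
      (L.tsLiftFamily Hts v) (p.comp (fgtP v)) (p'.comp (fgtP v)),
      HEq (liftη (embExt (InPortionThree (isArc := isArc) v) (.nv v)) L.diagram (logShapeTS (isArc := isArc) v).obs
        (L.tsLiftFamily Hts v) h)
        (Functor.whiskerRight (m.hom (L.lgenHom v)) (L.diagram.pathFunctor (fgtP (isArc := isArc) v))) := by
  have hF := graphEmbedding_embExt_nv (isArc := isArc) v
  have hS := isSieve_embExt_nv (isArc := isArc) v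
  obtain ⟨c, r, g, g', s, hp, hp'⟩ := m
  subst hp hp'
  obtain ⟨hg, eg⟩ := L.liftE_lgen_push Hts T v hobs s
  obtain ⟨h, e⟩ := lift_precomp hF hS hg r
  refine ⟨h, ?_⟩
  refine natTrans_heq_of_app_conj₂ (L.diagram.pathFunctor_comp (r.comp g) (fgtP v))
    (L.diagram.pathFunctor_comp (r.comp g') (fgtP v)) (fun x => ?_)
  have eg' := app_eq_conj_of_heq (L.diagram.pathFunctor_comp g (fgtP v)) (L.diagram.pathFunctor_comp g' (fgtP v)) eg
    ((L.diagram.pathFunctor r).obj x)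
  erw [e x, eg']
  simp only [Functor.whiskerRight_app, Functor.map_comp, eqToHom_map, DiagramOfCategories.Move.hom,
    DiagramOfCategories.moveHom_app]
  exact eqToHom_conj₂₂_eq rfl rfl HEq.rfl _ _ _ _ _ _ _ _

include hobs hrefl in
/-- **A CHAIN of `ι⊞`-moves pushed along `𝒩⊞_v → 𝒩_v`** is a lifting pair of `S_log_v` with the whiskered chain homotopy
(composition: abc-iut-L4-t5's `lift_trans`; the empty chain: `liftη_self`, the pushed path being a boundary path by `hrefl`).
[cite: MochizukiAbsTopIII2015, Definition 3.5 (ii) p.75] -/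
theorem liftE_chain_push {a : DVertex Vmod isArc} {p q : Path a (DVertex.nplus v)}
    (ch : DiagramOfCategories.Chain (LGen (isArc := isArc) v) p q) :
    ∃ h : liftE (embExt (InPortionThree (isArc := isArc) v) (.nv v)) L.diagram (logShapeTS (isArc := isArc) v).obs
      (L.tsLiftFamily Hts v) (p.comp (fgtP v)) (q.comp (fgtP v)),
      HEq (liftη (embExt (InPortionThree (isArc := isArc) v) (.nv v)) L.diagram (logShapeTS (isArc := isArc) v).obs
        (L.tsLiftFamily Hts v) h)
        (Functor.whiskerRight (ch.hom (L.lgenHom v)) (L.diagram.pathFunctor (fgtP (isArc := isArc) v))) := by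
  have hF := graphEmbedding_embExt_nv (isArc := isArc) v
  have hS := isSieve_embExt_nv (isArc := isArc) v
  induction ch with
  | nil p =>
    -- the pushed path lifts (sieve) and the diagonal pair is a boundary pair of `S_log_v` (`hrefl`)
    obtain ⟨a', p', ha, hp⟩ := hS.exists_mapPath (p.comp (fgtP v)) (b' := (logShapeTS (isArc := isArc) v).obs) rfl
    subst ha
    have h : liftE (embExt (InPortionThree (isArc := isArc) v) (.nv v)) L.diagram (logShapeTS (isArc := isArc) v).obs
      (L.tsLiftFamily Hts v) (p.comp (fgtP v)) (p.comp (fgtP v)) :=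
      ⟨⟨a', p', p', (HomotopyFamily.cast_E_iff (L.extend_eq_comapAlong (InPortionThree v) (.nv v)) (Hts v) p' p').mpr
        (hrefl p'), rfl, hp, hp⟩⟩
    refine ⟨h, ?_⟩
    rw [liftη_self hF h, DiagramOfCategories.Chain.hom, Functor.whiskerRight_id']
    exact heq_id_of_eq_functor (L.diagram.pathFunctor_comp p (fgtP v))
  | cons m rest ih =>
    obtain ⟨h₁, e₁⟩ := L.liftE_move_push Hts T v hobs m
    obtain ⟨h₂, e₂⟩ := ih
    obtain ⟨h₃, e₃⟩ := lift_trans hF h₁ h₂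
    refine ⟨h₃, ?_⟩
    rw [e₃, DiagramOfCategories.Chain.hom, Functor.whiskerRight_comp]
    exact heq_comp (L.diagram.pathFunctor_comp _ (fgtP v)) (L.diagram.pathFunctor_comp _ (fgtP v))
      (L.diagram.pathFunctor_comp _ (fgtP v)) e₁ e₂

end Push

/-! ## §3. The cross law from THEOREM B's datum to the `TS`-datum -/

section Cross

variable (A : ∀ (v : Vmod) (ν : LogVertex (isArc v)), ν.isPostLog = false → (L.lam v ν ⋙ L.forget v ⋙ L.toE v ≅ L.proj))
  (Ξ : L.log ⋙ L.proj ≅ L.proj) (hsq : ∀ v, L.IotaSquaresCommute v)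
  (hpre : ∀ (v : Vmod) (ν₁ ν₂ : LogVertex (isArc v)) (ε : LogEdge (isArc v) ν₁ ν₂) (h₁ : ν₁.isPostLog = false)
    (h₂ : ν₂.isPostLog = false) (X₀ : L.X), (L.toE v).map ((L.forget v).map ((L.iota v ε).app X₀)) ≍
    ((A v ν₁ h₁).hom.app X₀ ≫ (A v ν₂ h₂).inv.app X₀))
  (hpost : ∀ (v : Vmod) (ν₁ ν₂ : LogVertex (isArc v)) (ε : LogEdge (isArc v) ν₁ ν₂) (_ : ν₁.isPostLog = true)
    (h₂ : ν₂.isPostLog = false) (hsl : (LogVertex.spaceLink (isArc v)).isPostLog = false) (X₀ : L.X),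
    (L.toE v).map ((L.forget v).map ((L.iota v ε).app X₀)) ≍
    ((A v _ hsl).hom.app (L.log.obj X₀) ≫ Ξ.hom.app X₀ ≫ (A v ν₂ h₂).inv.app X₀))
  (Hts : ∀ v : Vmod, (L.logDiagramTS v).HomotopyFamily) (T : L.TSHomotopies)
  (hobs : ∀ v, L.IsLogObservableTS T v (Hts v))
  (hrefl : ∀ (v : Vmod) {a' : (logShapeTS (isArc := isArc) v).Vertex} (p : Path a' (logShapeTS (isArc := isArc) v).obs),
    (Hts v).E p p)

include hobs hrefl in
/-- ★ **The cross law `𝒩⊞_v → 𝒩_v`** (abc-iut-f-101's `RelLifts.CrossLaw`) from abc-iut-f-102's THEOREM-B datum to B1's `TS`-datum: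
a pair related at a pivot of the first, post-composed with a path into a pivot `𝒩_{v'}` of the second — necessarily an
`ι⊞`-chain at `𝒩⊞_v` followed by `𝒩⊞_v → 𝒩_v` (§1) — is a lifting pair of `S_log_v` with the whiskered chain homotopy (§2).
[cite: MochizukiAbsTopIII2015, Cor 5.5 (iii) p. 131] -/
theorem crossLaw_realises_ts :
    RelLifts.CrossLaw (L.realisesRelLifts A Ξ hsq hpre hpost) (L.tsRelLifts Hts) where
  rel := by
    rintro a w w' p q t hw ⟨v', rfl⟩ h
    obtain ⟨rfl, ht⟩ := path_pivot_nv hw t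
    cases ht
    exact (L.liftE_chain_push Hts T v' (hobs v') (fun p => hrefl v' p) (Classical.choice h)).1
  θ_heq := by
    rintro a w w' hw ⟨v', rfl⟩ p q t h h'
    obtain ⟨rfl, ht⟩ := path_pivot_nv hw t
    cases ht
    obtain ⟨h'', e⟩ := L.liftE_chain_push Hts T v' (hobs v') (fun p => hrefl v' p) (Classical.choice h)
    exact e

end Cross

end LogFrobeniusSetting

end Literature.AnabelianGeometry.AbsoluteAnabelian
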